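import Summits.KontsevichZagierPeriods.Zeta5Search.Barrier.ConeGammaTorus

/-!
# ζ(5) search — BARRIER: a kernel evaluator for Brown–Zudilin's saving exponent `𝒩` (path form + verified DP)

HONEST FRAMING (cell `pub-zeta5`): systematic search; no irrationality claim unless kernel-certified. MODEL objects
under Brown–Zudilin's (28)+(30) accounting ([BZ22] = arXiv:2210.03391); nothing here is a statement about `ζ(5)`;
records in print UNMOVED. Infrastructure (theory seat cert-2 g18) for discharging the `hΦ` hypotheses of the
record/flag/ridge `γ`-pins by a certificate table: the value of the torus saving function `torusN θ = max_σ torusTerm θ σ`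
(`ConeGammaTorus`) at a point `θ` from the 28 integer parts `⌊pairForm θ i j⌋`, WITHOUT enumerating `S₇` in the kernel.

* `pathVal θ e` and **`torusTerm_eq_pathVal`** — the PATH FORM: `torusTerm θ σ = pathVal θ σ̃ − pathVal θ id`, where
  `pathVal θ e = Σ_{edges of the path 3–5–4–6–1–7–2, relabelled by e} ⌊pairForm θ⌋ − ⌊pairForm θ 0 (e 3)⌋ − ⌊pairForm θ 0 (e 2)⌋`
  (the complement `F^c` of (27) is that Hamiltonian path of `K₇` plus the five `{0,j}` pairs at its interior vertices;
  `Σ_{all 28}` and `Σ_{all seven {0,j}}` are `S₇`-invariant). So `𝒩(θ) = max over Hamiltonian paths − (value at the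
  identity)`: a longest-path problem on 7 vertices.
* `dpBuild` / `dpCheck` / **`pathW_le_of_dpCheck`** — a subset dynamic programme (Held–Karp shape, 448 states) whose table
  is built by an untrusted function and then VERIFIED inequality by inequality (`dpCheck`, over `List.sublists'`); the
  soundness theorem bounds the weight of every duplicate-free vertex list by the table entry.
* **`torusN_le_of_cert`** / **`le_torusN_of_witness`** / **`torusN_eq_of_cert`** — `𝒩(θ) = c` from: the 28 floors
  (`hn`), `dpCheck`, the DP maximum `≤ c + (identity value)`, and ONE witness ordering attaining `c`.
Kernel cost ≈ 0.3 s per evaluation (`decide +kernel`), against ≈ 13 s for the 5040-fold enumeration (measured).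
-/

namespace Summit.KontsevichZagierPeriods.Zeta5Search.Barrier.ConeGamma

open Finset

/-! ### The path form of the torus term -/

/-- The value of the relabelled complement path: the six edges `{3,5},{4,6},{1,6},{1,7},{4,5},{2,7}` of the Hamiltonian
path `3–5–4–6–1–7–2` (= `hamIdx`, table orientation) minus the two end terms `{0,2},{0,3}` (= `endIdx`). -/
noncomputable def pathVal (θ : Fin 8 → ℝ) (e : Fin 8 → Fin 8) : ℤ :=
  ⌊pairForm θ (e 3) (e 5)⌋ + ⌊pairForm θ (e 4) (e 6)⌋ + ⌊pairForm θ (e 1) (e 6)⌋ + ⌊pairForm θ (e 1) (e 7)⌋ +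
    ⌊pairForm θ (e 4) (e 5)⌋ + ⌊pairForm θ (e 2) (e 7)⌋ - ⌊pairForm θ 0 (e 2)⌋ - ⌊pairForm θ 0 (e 3)⌋

/-- The five `{0,j}` forms of `F^c` (interior vertices `1,4,5,6,7` of the path): indices `{11,12,14,16,23}`. -/
def midIdx : Finset (Fin 28) := {11, 12, 14, 16, 23}

/-- The sum of all 28 integer parts is `S₇`-invariant. -/
theorem sum_univ_floor_phiForm_permS (σ : Equiv.Perm (Fin 7)) (θ : Fin 8 → ℝ) :
    ∑ k : Fin 28, ⌊phiForm (permS σ θ) k⌋ = ∑ k : Fin 28, ⌊phiForm θ k⌋ := by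
  have h := sum_univ_phiForm_permS (fun x => ((⌊x⌋ : ℤ) : ℝ)) σ θ
  exact_mod_cast h

/-- The sum of the seven `{0,j}` integer parts is `S₇`-invariant. -/
theorem sum_zeroIdx_floor_permS (σ : Equiv.Perm (Fin 7)) (θ : Fin 8 → ℝ) :
    ∑ i ∈ zeroIdx, ⌊phiForm (permS σ θ) i⌋ = ∑ i ∈ zeroIdx, ⌊phiForm θ i⌋ := by
  have h1 : ∑ i ∈ zeroIdx, ⌊phiForm (permS σ θ) i⌋ = ∑ j : Fin 7, ⌊θ 0 - θ (σ j).succ⌋ := by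
    simp [zeroIdx, phiForm_permS, fstIdx, sndIdx, pairForm, Fin.sum_univ_seven]
    ring
  have h2 : ∑ i ∈ zeroIdx, ⌊phiForm θ i⌋ = ∑ j : Fin 7, ⌊θ 0 - θ j.succ⌋ := by
    simp [zeroIdx, phiForm_eq, fstIdx, sndIdx, pairForm, Fin.sum_univ_seven]
    ring
  rw [h1, h2]
  exact Equiv.sum_comp σ (fun j => ⌊θ 0 - θ j.succ⌋)

/-- `Σ_{ham} ⌊φ(σθ)⌋ − Σ_{ends} ⌊φ(σθ)⌋ = pathVal θ σ̃`. -/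
theorem sum_hamIdx_sub_endIdx_permS (σ : Equiv.Perm (Fin 7)) (θ : Fin 8 → ℝ) :
    ∑ i ∈ hamIdx, ⌊phiForm (permS σ θ) i⌋ - ∑ i ∈ endIdx, ⌊phiForm (permS σ θ) i⌋ = pathVal θ (liftPerm σ) := by
  simp [hamIdx, endIdx, phiForm_permS, fstIdx, sndIdx, pathVal]
  ring

/-- `Σ_{ham} ⌊φ(θ)⌋ − Σ_{ends} ⌊φ(θ)⌋ = pathVal θ id`. -/
theorem sum_hamIdx_sub_endIdx (θ : Fin 8 → ℝ) :
    ∑ i ∈ hamIdx, ⌊phiForm θ i⌋ - ∑ i ∈ endIdx, ⌊phiForm θ i⌋ = pathVal θ id := by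
  simp [hamIdx, endIdx, phiForm_eq, fstIdx, sndIdx, pathVal]
  ring

/-- **PATH FORM of the torus term**: `torusTerm θ σ = pathVal θ σ̃ − pathVal θ id`. -/
theorem torusTerm_eq_pathVal (θ : Fin 8 → ℝ) (σ : Equiv.Perm (Fin 7)) :
    torusTerm θ σ = pathVal θ (liftPerm σ) - pathVal θ id := by
  have hall := sum_univ_floor_phiForm_permS σ θ
  have hz := sum_zeroIdx_floor_permS σ θ
  have hcompl : FIdxᶜ = hamIdx ∪ midIdx := by decide
  have hzero : zeroIdx = endIdx ∪ midIdx := by decide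
  have hd1 : Disjoint hamIdx midIdx := by decide
  have hd2 : Disjoint endIdx midIdx := by decide
  rw [← Finset.sum_add_sum_compl FIdx, ← Finset.sum_add_sum_compl FIdx (fun k => ⌊phiForm θ k⌋), hcompl,
    Finset.sum_union hd1, Finset.sum_union hd1] at hall
  rw [hzero, Finset.sum_union hd2, Finset.sum_union hd2] at hz
  rw [← sum_hamIdx_sub_endIdx_permS, ← sum_hamIdx_sub_endIdx]
  unfold torusTerm
  rw [Finset.sum_sub_distrib]
  linarith

/-! ### A verified subset DP for the longest relabelled path -/

/-- Bit-sum key of a vertex list (vertices `0..6` stand for `1..7`). -/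
def key (S : List ℕ) : ℕ := (S.map fun k => 2 ^ k).sum

/-- Weight of a vertex list read from its END: `[k]` ↦ `−n 0 (k+1)` (the path's first end term), and each further
vertex adds the edge to its predecessor. -/
def pathW (n : ℕ → ℕ → ℤ) : List ℕ → ℤ
  | [] => 0
  | [k] => -n 0 (k + 1)
  | k :: l :: rest => n (l + 1) (k + 1) + pathW n (l :: rest)

/-- Decoder of a DP table packed in base `2^14` with offset `2^12`: entry `(S, v)` at digit `7S + v`. -/
def tblOf (D : ℕ) (S v : ℕ) : ℤ := ((D / 16384 ^ (7 * S + v) % 16384 : ℕ) : ℤ) - 4096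

/-- Maximum of an option-valued family over a list (`-4096` if empty). -/
def omax (l : List ℕ) (f : ℕ → Option ℤ) : ℤ :=
  l.foldr (fun u acc => match f u with | some x => max x acc | none => acc) (-4096)

/-- UNTRUSTED builder of the DP table `T[S][v] = max over duplicate-free lists with key S and head v of pathW`
(subsets in increasing order; verified afterwards by `dpCheck`). -/
def dpBuild (n : ℕ → ℕ → ℤ) : ℕ :=
  (List.range 128).foldl (fun D S => (List.range 7).foldl (fun D v =>
    if S / 2 ^ v % 2 = 1 then
      let val : ℤ := if S = 2 ^ v then -n 0 (v + 1) else
        omax (List.range 7) fun u =>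
          if u ≠ v ∧ S / 2 ^ u % 2 = 1 then some (tblOf D (S - 2 ^ v) u + n (u + 1) (v + 1)) else none
      D + (val + 4096).toNat * 16384 ^ (7 * S + v)
    else D) D) 0

/-- All sub-lists of a list (kernel-friendly structural copy of `List.sublists'`). -/
def subsets : List ℕ → List (List ℕ)
  | [] => [[]]
  | a :: l => subsets l ++ (subsets l).map (List.cons a)

/-- `subsets = List.sublists'`. -/
theorem subsets_eq_sublists' (l : List ℕ) : subsets l = l.sublists' := by
  induction l with
  | nil => rfl
  | cons a l ih => rw [subsets, ih, List.sublists'_cons]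

/-- VERIFIER of a DP table: the recurrence inequalities on every sub-list of `[0,…,6]`. -/
def dpCheck (n : ℕ → ℕ → ℤ) (tbl : ℕ → ℕ → ℤ) : Bool :=
  (subsets (List.range 7)).all fun S => S.all fun v =>
    (!(S.length == 1) || decide (-n 0 (v + 1) ≤ tbl (key S) v)) &&
      S.all fun u => (u == v) || decide (tbl (key (S.erase v)) u + n (u + 1) (v + 1) ≤ tbl (key S) v)

/-- `key` is permutation invariant. -/
theorem key_eq_of_perm {S T : List ℕ} (h : S.Perm T) : key S = key T :=
  (h.map _).sum_eq

/-- **Soundness of the DP verifier**: every non-empty duplicate-free list of vertices `< 7` weighs at most the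
table entry at its key and head. -/
theorem pathW_le_of_dpCheck {n : ℕ → ℕ → ℤ} {tbl : ℕ → ℕ → ℤ} (h : dpCheck n tbl = true) :
    ∀ p : List ℕ, p ≠ [] → p.Nodup → (∀ k ∈ p, k < 7) → ∀ k, p.head? = some k → pathW n p ≤ tbl (key p) k := by
  unfold dpCheck at h
  rw [List.all_eq_true] at h
  intro p
  induction p with
  | nil => intro h0; exact absurd rfl h0
  | cons k rest ih =>
    intro _ hnd hlt k' hk'
    simp only [List.head?_cons, Option.some.injEq] at hk'
    subst hk'
    -- a sorted copy of `p` among the sublists of `[0..6]`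
    have hsub : (k :: rest) ⊆ List.range 7 := fun x hx => List.mem_range.2 (hlt x hx)
    obtain ⟨s, hps, hs⟩ := hnd.subperm hsub
    have hmem : s ∈ subsets (List.range 7) := by rw [subsets_eq_sublists']; exact List.mem_sublists'.2 hs
    have hS := h s hmem
    rw [List.all_eq_true] at hS
    have hks : k ∈ s := hps.symm.subset List.mem_cons_self
    have hk := hS k hks
    rw [Bool.and_eq_true] at hk
    obtain ⟨hbase, hstep⟩ := hk
    have hkey : key s = key (k :: rest) := key_eq_of_perm hps
    cases rest with
    | nil =>
      -- singleton
      have hs1 : s = [k] := List.perm_singleton.1 hps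
      subst hs1
      simp only [List.length_singleton, beq_self_eq_true, Bool.not_true, Bool.false_or, decide_eq_true_eq] at hbase
      simpa [pathW, key] using hbase
    | cons l rest' =>
      have hl : l ∈ s := hps.symm.subset (List.mem_cons_of_mem _ List.mem_cons_self)
      rw [List.all_eq_true] at hstep
      have hst := hstep l hl
      have hne : l ≠ k := by
        intro hlk
        subst hlk
        exact (List.nodup_cons.1 hnd).1 List.mem_cons_self
      have hlk : (l == k) = false := beq_false_of_ne hne
      rw [hlk, Bool.false_or, decide_eq_true_eq] at hst
      -- induction hypothesis for the tail
      have hnd' : (l :: rest').Nodup := (List.nodup_cons.1 hnd).2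
      have hlt' : ∀ x ∈ l :: rest', x < 7 := fun x hx => hlt x (List.mem_cons_of_mem _ hx)
      have hih := ih (List.cons_ne_nil _ _) hnd' hlt' l rfl
      have hkey' : key (s.erase k) = key (l :: rest') := by
        have hpe : (s.erase k).Perm ((k :: l :: rest').erase k) := hps.erase k
        rw [List.erase_cons_head] at hpe
        exact key_eq_of_perm hpe
      rw [hkey', hkey] at hst
      simp only [pathW]
      linarith

/-- The DP maximum over Hamiltonian paths (read at the full key `127` with the second end term). -/
def dpMax (n : ℕ → ℕ → ℤ) (tbl : ℕ → ℕ → ℤ) : ℤ :=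
  ((List.range 7).map fun v => tbl 127 v - n 0 (v + 1)).foldr max (-1000000)

/-- **Every Hamiltonian vertex list weighs at most `dpMax`** (weight = `pathW − n 0 (head+1)`). -/
theorem pathW_sub_le_dpMax {n : ℕ → ℕ → ℤ} {tbl : ℕ → ℕ → ℤ} (h : dpCheck n tbl = true) {p : List ℕ}
    (hp : p.Perm (List.range 7)) {k : ℕ} (hk : p.head? = some k) : pathW n p - n 0 (k + 1) ≤ dpMax n tbl := by
  have hne : p ≠ [] := by rintro rfl; simp at hk
  have hle := pathW_le_of_dpCheck h p hne (hp.nodup_iff.2 List.nodup_range)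
    (fun x hx => List.mem_range.1 (hp.subset hx)) k hk
  have hkey : key p = 127 := by rw [key_eq_of_perm hp]; decide
  rw [hkey] at hle
  have hk7 : k < 7 := by
    have : k ∈ p := List.mem_of_mem_head? hk
    exact List.mem_range.1 (hp.subset this)
  have hmem : tbl 127 k - n 0 (k + 1) ∈ (List.range 7).map fun v => tbl 127 v - n 0 (v + 1) :=
    List.mem_map.2 ⟨k, List.mem_range.2 hk7, rfl⟩
  have aux : ∀ (l : List ℤ) (b : ℤ) {x : ℤ}, x ∈ l → x ≤ l.foldr max b := by
    intro l b x hx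
    induction l with
    | nil => exact (List.not_mem_nil hx).elim
    | cons y ys ih =>
      simp only [List.foldr_cons]
      rcases List.mem_cons.1 hx with rfl | h
      · exact le_max_left _ _
      · exact (ih h).trans (le_max_right _ _)
  exact le_trans (by linarith) (aux _ _ hmem)

/-! ### From the table of integer parts to `𝒩(θ)` -/

/-! Below, `hn : ∀ i j : Fin 8, i ≠ j → ⌊pairForm θ i j⌋ = n i j` says that the 56 integer parts are given by the
table `n` (vertex numbers `0..7`; both orientations). -/

/-- `pathVal θ id` read from the table. -/
def pathValId (n : ℕ → ℕ → ℤ) : ℤ := n 3 5 + n 4 6 + n 1 6 + n 1 7 + n 4 5 + n 2 7 - n 0 2 - n 0 3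

/-- `pathVal θ σ̃` read from the table, `w = [σ 0, …, σ 6]` (0-based values; vertex `v ↦ w[v-1] + 1`). -/
def pathValN (n : ℕ → ℕ → ℤ) (w : List ℕ) : ℤ :=
  n (w.getD 2 0 + 1) (w.getD 4 0 + 1) + n (w.getD 3 0 + 1) (w.getD 5 0 + 1) + n (w.getD 0 0 + 1) (w.getD 5 0 + 1) +
    n (w.getD 0 0 + 1) (w.getD 6 0 + 1) + n (w.getD 3 0 + 1) (w.getD 4 0 + 1) + n (w.getD 1 0 + 1) (w.getD 6 0 + 1) -
    n 0 (w.getD 1 0 + 1) - n 0 (w.getD 2 0 + 1)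

/-- `(σ̃ (k+1)).val = (σ k).val + 1`. -/
theorem val_liftPerm_succ (σ : Equiv.Perm (Fin 7)) (k : Fin 7) : ((liftPerm σ k.succ : Fin 8) : ℕ) = (σ k : ℕ) + 1 := by
  simp

/-- `pathVal θ id` from the table. -/
theorem pathVal_id_eq {θ : Fin 8 → ℝ} {n : ℕ → ℕ → ℤ} (hn : ∀ i j : Fin 8, i ≠ j → ⌊pairForm θ i j⌋ = n i j) : pathVal θ id = pathValId n := by
  unfold pathVal pathValId
  simp only [id]
  rw [hn 3 5 (by decide), hn 4 6 (by decide), hn 1 6 (by decide), hn 1 7 (by decide), hn 4 5 (by decide),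
    hn 2 7 (by decide), hn 0 2 (by decide), hn 0 3 (by decide)]
  rfl

/-- `pathVal θ σ̃` from the table (list of the seven values of `σ`). -/
theorem pathVal_liftPerm_eq {θ : Fin 8 → ℝ} {n : ℕ → ℕ → ℤ} (hn : ∀ i j : Fin 8, i ≠ j → ⌊pairForm θ i j⌋ = n i j) (σ : Equiv.Perm (Fin 7)) :
    pathVal θ (liftPerm σ) = pathValN n ((List.finRange 7).map fun j => (σ j : ℕ)) := by
  have hinj : ∀ {a b : Fin 8}, a ≠ b → liftPerm σ a ≠ liftPerm σ b := fun h => (liftPerm σ).injective.ne h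
  unfold pathVal pathValN
  rw [hn _ _ (hinj (by decide : (3 : Fin 8) ≠ 5)), hn _ _ (hinj (by decide : (4 : Fin 8) ≠ 6)),
    hn _ _ (hinj (by decide : (1 : Fin 8) ≠ 6)), hn _ _ (hinj (by decide : (1 : Fin 8) ≠ 7)),
    hn _ _ (hinj (by decide : (4 : Fin 8) ≠ 5)), hn _ _ (hinj (by decide : (2 : Fin 8) ≠ 7)),
    hn _ _ (by rw [ne_eq, eq_comm, liftPerm_eq_zero]; decide : (0 : Fin 8) ≠ liftPerm σ 2),
    hn _ _ (by rw [ne_eq, eq_comm, liftPerm_eq_zero]; decide : (0 : Fin 8) ≠ liftPerm σ 3)]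
  rw [show List.finRange 7 = [0, 1, 2, 3, 4, 5, 6] from by decide]
  simp

/-- `pathVal θ σ̃` as a `pathW` weight of the reversed relabelled path (for the DP bound). -/
theorem pathVal_liftPerm_eq_pathW {θ : Fin 8 → ℝ} {n : ℕ → ℕ → ℤ} (hn : ∀ i j : Fin 8, i ≠ j → ⌊pairForm θ i j⌋ = n i j) (σ : Equiv.Perm (Fin 7)) :
    pathVal θ (liftPerm σ) =
      pathW n [(σ 1 : ℕ), (σ 6 : ℕ), (σ 0 : ℕ), (σ 5 : ℕ), (σ 3 : ℕ), (σ 4 : ℕ), (σ 2 : ℕ)] - n 0 ((σ 1 : ℕ) + 1) := by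
  have hinj : ∀ {a b : Fin 8}, a ≠ b → liftPerm σ a ≠ liftPerm σ b := fun h => (liftPerm σ).injective.ne h
  unfold pathVal
  simp only [pathW]
  rw [pairForm_comm θ (liftPerm σ 1) (liftPerm σ 6), pairForm_comm θ (liftPerm σ 4) (liftPerm σ 5),
    pairForm_comm θ (liftPerm σ 2) (liftPerm σ 7)]
  rw [hn _ _ (hinj (by decide : (3 : Fin 8) ≠ 5)), hn _ _ (hinj (by decide : (4 : Fin 8) ≠ 6)),
    hn _ _ (hinj (by decide : (6 : Fin 8) ≠ 1)), hn _ _ (hinj (by decide : (1 : Fin 8) ≠ 7)),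
    hn _ _ (hinj (by decide : (5 : Fin 8) ≠ 4)), hn _ _ (hinj (by decide : (7 : Fin 8) ≠ 2)),
    hn _ _ (by rw [ne_eq, eq_comm, liftPerm_eq_zero]; decide : (0 : Fin 8) ≠ liftPerm σ 2),
    hn _ _ (by rw [ne_eq, eq_comm, liftPerm_eq_zero]; decide : (0 : Fin 8) ≠ liftPerm σ 3)]
  simp only [Fin.val_zero, liftPerm_one, liftPerm_two, liftPerm_three, liftPerm_four, liftPerm_five, liftPerm_six,
    liftPerm_seven, Fin.val_succ]
  ring

/-- The reversed relabelled path is a permutation of `[0,…,6]`. -/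
theorem perm_range_of_perm (σ : Equiv.Perm (Fin 7)) :
    [(σ 1 : ℕ), (σ 6 : ℕ), (σ 0 : ℕ), (σ 5 : ℕ), (σ 3 : ℕ), (σ 4 : ℕ), (σ 2 : ℕ)].Perm (List.range 7) := by
  have h1 : [(σ 1 : ℕ), (σ 6 : ℕ), (σ 0 : ℕ), (σ 5 : ℕ), (σ 3 : ℕ), (σ 4 : ℕ), (σ 2 : ℕ)] =
      (([1, 6, 0, 5, 3, 4, 2] : List (Fin 7)).map σ).map Fin.val := by simp
  have h2 : (([1, 6, 0, 5, 3, 4, 2] : List (Fin 7)).map σ).Perm ((List.finRange 7).map σ) :=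
    (by decide : ([1, 6, 0, 5, 3, 4, 2] : List (Fin 7)).Perm (List.finRange 7)).map σ
  have h3 : ((List.finRange 7).map σ).Perm (List.finRange 7) := Equiv.Perm.map_finRange_perm σ
  rw [h1, ← List.map_coe_finRange_eq_range]
  exact (h2.trans h3).map _

/-- **UPPER BOUND**: `𝒩(θ) ≤ dpMax − pathVal(id)` from the table and a verified DP table. -/
theorem torusN_le_of_cert {θ : Fin 8 → ℝ} {n : ℕ → ℕ → ℤ} (hn : ∀ i j : Fin 8, i ≠ j → ⌊pairForm θ i j⌋ = n i j) {tbl : ℕ → ℕ → ℤ}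
    (hdp : dpCheck n tbl = true) : torusN θ ≤ dpMax n tbl - pathValId n := by
  unfold torusN
  refine Finset.sup'_le _ _ fun σ _ => ?_
  rw [torusTerm_eq_pathVal, pathVal_id_eq hn, pathVal_liftPerm_eq_pathW hn]
  have h := pathW_sub_le_dpMax hdp (perm_range_of_perm σ) (k := (σ 1 : ℕ)) rfl
  linarith

/-- A duplicate-free list of seven elements of `Fin 7` contains every element. -/
theorem forall_mem_of_nodup_seven {w : List (Fin 7)} (hw : w.Nodup) (hlen : w.length = 7) : ∀ x : Fin 7, x ∈ w := by
  intro x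
  have hcard : w.toFinset.card = 7 := by rw [List.toFinset_card_of_nodup hw, hlen]
  have huniv : w.toFinset = Finset.univ := Finset.eq_univ_of_card _ (by rw [hcard]; simp)
  have : x ∈ w.toFinset := by rw [huniv]; exact Finset.mem_univ _
  exact List.mem_toFinset.1 this

/-- The permutation with value list `w`. -/
def permOfList (w : List (Fin 7)) (hw : w.Nodup) (hlen : w.length = 7) : Equiv.Perm (Fin 7) :=
  (finCongr hlen.symm).trans (hw.getEquivOfForallMemList w (forall_mem_of_nodup_seven hw hlen))

/-- Its value list is `w`. -/
theorem map_permOfList (w : List (Fin 7)) (hw : w.Nodup) (hlen : w.length = 7) :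
    (List.finRange 7).map (fun j => (permOfList w hw hlen j : ℕ)) = w.map Fin.val := by
  apply List.ext_getElem
  · simp [hlen]
  · intro i h1 h2
    simp [permOfList, List.Nodup.getEquivOfForallMemList]

/-- **LOWER BOUND** from ONE witness ordering `w` (the value list of a permutation). -/
theorem le_torusN_of_witness {θ : Fin 8 → ℝ} {n : ℕ → ℕ → ℤ} (hn : ∀ i j : Fin 8, i ≠ j → ⌊pairForm θ i j⌋ = n i j) (w : List (Fin 7)) (hw : w.Nodup)
    (hlen : w.length = 7) : pathValN n (w.map Fin.val) - pathValId n ≤ torusN θ := by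
  unfold torusN
  have h := Finset.le_sup' (torusTerm θ) (Finset.mem_univ (permOfList w hw hlen))
  rw [torusTerm_eq_pathVal, pathVal_id_eq hn, pathVal_liftPerm_eq hn, map_permOfList] at h
  exact h

/-- **`𝒩(θ) = c`** from the table, a verified DP table bounding the maximum by `c`, and a witness attaining `c`. -/
theorem torusN_eq_of_cert {θ : Fin 8 → ℝ} {n : ℕ → ℕ → ℤ} (hn : ∀ i j : Fin 8, i ≠ j → ⌊pairForm θ i j⌋ = n i j) {tbl : ℕ → ℕ → ℤ}
    (hdp : dpCheck n tbl = true) {c : ℤ} (hup : dpMax n tbl - pathValId n ≤ c) {w : List (Fin 7)} (hw : w.Nodup)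
    (hlen : w.length = 7) (hlo : c ≤ pathValN n (w.map Fin.val) - pathValId n) : torusN θ = c :=
  le_antisymm ((torusN_le_of_cert hn hdp).trans hup) (hlo.trans (le_torusN_of_witness hn w hw hlen))

end Summit.KontsevichZagierPeriods.Zeta5Search.Barrier.ConeGamma
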